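import Mathlib
import Summits.Ventures.PercRepro2.CrossAPrimeA2Route

/-!
# The `a₂`-side route for the sign of `crossA′so`, II: admissible constants and the induction
(blind cell PercRepro2, p5 g34; S4 §2.4 (s) addendum 27 (4))

The admissible constants for `crossC` are those dominating the connection probability
`P(a₁ ↔ v in G ∖ W)` for every `W` containing the sure cluster of `a₂` and not `a₁`
(**`Adm`**); admissibility is preserved by pinning an edge at the sure cluster of `a₂`
(`adm_update_zero`, `adm_update_one`), by re-rooting `a₂` inside its sure cluster (`adm_reroot`),
and `c = P(a₁ ↔ v in G ∖ {a₂}) ≤ π` is admissible (`adm_del_a2`, `prob_del_a2_le`).  The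
induction on the random edges at the sure cluster of `a₂` (loops free, re-rooting, the
deterministic base of `CrossAPrimeA2Route`) closes from the open step **`A2Step`** — the middle
coefficient `Φ₀₁ + Φ₁₀ ≥ 0` of the one-edge quadratic along a random edge `{a₂, w}`, `w ≠ a₁`,
under the induction hypotheses and an admissible `c`: **`crossC_nonneg_of_a2Step`**,
**`crossA'so_nonneg_of_a2Step`**.  Own work; standard axioms.
-/

namespace Summit.Ventures.PercRepro2

open LeafRowPendantRootSO CrossAPrimeA1VMid CrossAPrimeSupport CrossAPrimeRootEdge
  CrossAPrimeInduction CrossAPrimeA2Route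

namespace CrossAPrimeA2Induction

section DelConn

variable {V : Type*} {E : Type*} {ends : E → Sym2 V}

/-- The event `{a₁ ↔ v in G ∖ W}`. -/
def delConn (ends : E → Sym2 V) (W : Set V) (a₁ v : V) : Set (Config E) :=
  {ω | Conn ends (delConfig ends W ω) a₁ v}

/-- `{a₁ ↔ v in G ∖ W}` only sees the edges not touching `W`. -/
lemma dependsOn_delConn (W : Set V) (a₁ v : V) :
    DependsOn (· ∈ delConn ends W a₁ v) (touches ends W)ᶜ := by
  intro ω ω' h
  simp only [delConn, Set.mem_setOf_eq]
  rw [delConfig_congr h]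

/-- Closing the edges at `W` gives a smaller configuration. -/
lemma delConfig_le (W : Set V) (ω : Config E) : delConfig ends W ω ≤ ω := by
  intro e
  by_cases he : e ∈ touches ends W
  · rw [delConfig_apply_of_mem he]
    exact Bool.false_le _
  · rw [delConfig_apply_of_notMem he]

end DelConn

section Adm

variable {V : Type*} {E : Type*} [Fintype E] [DecidableEq E] {R : Type*} [Field R]
  [LinearOrder R] [IsStrictOrderedRing R]
variable {ends : E → Sym2 V}

/-- **Admissible constants**: `c` dominates `P(a₁ ↔ v in G ∖ W)` for every `W ⊇ C_{sure}(a₂)`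
not containing `a₁`. -/
def Adm (p : E → R) (c : R) (ends : E → Sym2 V) (a₁ a₂ v : V) : Prop :=
  ∀ W : Set V, cluster ends (sureConfig p) a₂ ⊆ W → a₁ ∉ W → prob p (delConn ends W a₁ v) ≤ c

omit [IsStrictOrderedRing R] in
/-- Re-rooting `a₂` inside its sure cluster does not change admissibility. -/
lemma adm_reroot {p : E → R} {c : R} {a₁ a₂ t v : V} (ht : Conn ends (sureConfig p) a₂ t)
    (h : Adm p c ends a₁ a₂ v) : Adm p c ends a₁ t v := by
  intro W hW ha
  rw [CrossAPrimeA2Route.cluster_eq_of_conn ht] at hW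
  exact h W hW ha

omit [LinearOrder R] [IsStrictOrderedRing R] in
/-- An event determined by the edges not touching `A` has the same probability under `p` and
`p[e ↦ 0]` when `e` touches `A`. -/
lemma prob_update_zero_of_dependsOn' {p : E → R} {e : E} {A : Set V} (he : e ∈ touches ends A)
    {S : Set (Config E)} (hS : DependsOn (· ∈ S) (touches ends A)ᶜ) :
    prob (Function.update p e 0) S = prob p S := by
  refine (RBRootEdge.prob_update_zero_eq p e S).trans ?_
  congr 1
  ext ω
  simp only [Set.mem_setOf_eq]
  exact dependsOn_mem_iff hS fun e' he' => by
    rw [Function.update_of_ne]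
    rintro rfl
    exact he' he

omit [LinearOrder R] [IsStrictOrderedRing R] in
/-- … and under `p[e ↦ 1]`. -/
lemma prob_update_one_of_dependsOn' {p : E → R} {e : E} {A : Set V} (he : e ∈ touches ends A)
    {S : Set (Config E)} (hS : DependsOn (· ∈ S) (touches ends A)ᶜ) :
    prob (Function.update p e 1) S = prob p S := by
  refine (RBRootEdge.prob_update_one_eq p e S).trans ?_
  congr 1
  ext ω
  simp only [Set.mem_setOf_eq]
  exact dependsOn_mem_iff hS fun e' he' => by
    rw [Function.update_of_ne]
    rintro rfl
    exact he' he

omit [IsStrictOrderedRing R] in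
/-- Admissibility is preserved by pinning an edge at the sure cluster of `a₂` closed. -/
lemma adm_update_zero {p : E → R} {c : R} {a₁ a₂ v : V} (h : Adm p c ends a₁ a₂ v) {e : E}
    (he : e ∈ touches ends (cluster ends (sureConfig p) a₂)) (h1 : p e ≠ 1) :
    Adm (Function.update p e 0) c ends a₁ a₂ v := by
  intro W hW ha
  rw [sureConfig_update_zero p h1] at hW
  rw [prob_update_zero_of_dependsOn' (touches_mono hW he) (dependsOn_delConn W a₁ v)]
  exact h W hW ha

omit [Fintype E] [IsStrictOrderedRing R] in
/-- The sure configuration after pinning an edge open. -/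
lemma sureConfig_update_one (p : E → R) (e : E) :
    sureConfig (Function.update p e 1) = Function.update (sureConfig p) e true := by
  funext f
  by_cases hf : f = e
  · subst hf
    simp [sureConfig]
  · simp [sureConfig, Function.update_of_ne hf]

omit [IsStrictOrderedRing R] in
/-- Admissibility is preserved by pinning an edge at the sure cluster of `a₂` open. -/
lemma adm_update_one {p : E → R} {c : R} {a₁ a₂ v : V} (h : Adm p c ends a₁ a₂ v) {e : E}
    (he : e ∈ touches ends (cluster ends (sureConfig p) a₂)) :
    Adm (Function.update p e 1) c ends a₁ a₂ v := by
  intro W hW ha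
  have hS : cluster ends (sureConfig p) a₂ ⊆ cluster ends (sureConfig (Function.update p e 1)) a₂ := by
    rw [sureConfig_update_one]
    exact cluster_mono (OneEdge.le_update_true _ _) a₂
  rw [prob_update_one_of_dependsOn' (touches_mono (hS.trans hW) he)
    (dependsOn_delConn W a₁ v)]
  exact h W (hS.trans hW) ha

/-- `c = P(a₁ ↔ v in G ∖ {a₂})` is admissible. -/
lemma adm_del_a2 {p : E → R} (hp : IsProbVec p) (a₁ a₂ v : V) :
    Adm p (prob p (delConn ends {a₂} a₁ v)) ends a₁ a₂ v := by
  intro W hW _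
  apply prob_mono hp
  intro ω hω
  have h2 : ({a₂} : Set V) ⊆ W := Set.singleton_subset_iff.2 (hW (mem_cluster_self ends _ a₂))
  exact conn_mono (delConfig_anti h2 ω) hω

/-- `P(a₁ ↔ v in G ∖ {a₂}) ≤ π`. -/
lemma prob_del_a2_le {p : E → R} (hp : IsProbVec p) (a₁ a₂ v : V) :
    prob p (delConn ends {a₂} a₁ v) ≤ prob p (connEvent ends a₁ v) :=
  prob_mono hp fun ω hω => conn_mono (delConfig_le {a₂} ω) hω

end Adm

section Induction

variable {V : Type*} {E : Type*} [Fintype E] [DecidableEq E] [Fintype V] [DecidableEq V]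
  {R : Type*} [Field R] [LinearOrder R] [IsStrictOrderedRing R]
variable {ends : E → Sym2 V}

/-- **The open step of the `a₂`-side induction**: along every random edge `e = {r, w}` at the
(re-rooted) `a₂ = r`, `w ≠ a₁`, for every admissible constant `c`, under the induction
hypotheses `0 ≤ crossC(p[e ↦ 0])`, `0 ≤ crossC(p[e ↦ 1])`, the middle coefficient of the
quadratic is nonnegative: `0 ≤ Φ₀₁ + Φ₁₀`. -/
def A2Step (ends : E → Sym2 V) (o a₁ v b : V) : Prop :=
  ∀ (p : E → R) (r w : V) (e : E) (c : R), IsProbVec p → ends e = s(r, w) → r ≠ w → w ≠ a₁ →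
    p e ≠ 0 → p e ≠ 1 → Adm p c ends a₁ r v →
    0 ≤ crossC (Function.update p e 0) c ends o a₁ r v b →
    0 ≤ crossC (Function.update p e 1) c ends o a₁ r v b →
    0 ≤ crossPatC (Function.update p e 0) (Function.update p e 1) c ends o a₁ r v b +
      crossPatC (Function.update p e 1) (Function.update p e 0) c ends o a₁ r v b

/-- **The `a₂`-side induction**: `A2Step` gives `0 ≤ crossC p c` for every `p`, every `a₂` and
every admissible `c ≥ 0`, by induction on the random edges at the sure cluster of `a₂`. -/
theorem crossC_nonneg_of_a2Step {o a₁ v b : V} (H : A2Step (R := R) ends o a₁ v b) :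
    ∀ (p : E → R), IsProbVec p → ∀ c : R, 0 ≤ c → ∀ a₂, Adm p c ends a₁ a₂ v →
      0 ≤ crossC p c ends o a₁ a₂ v b := by
  suffices h : ∀ n, ∀ (p : E → R), IsProbVec p → (randomEdges p).card = n →
      ∀ c : R, 0 ≤ c → ∀ a₂, Adm p c ends a₁ a₂ v → 0 ≤ crossC p c ends o a₁ a₂ v b from
    fun p hp c hc a₂ hadm => h _ p hp rfl c hc a₂ hadm
  intro n
  induction n with
  | zero =>
    intro p hp hcard c hc a₂ _
    apply crossC_nonneg_of_det hc
    intro e _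
    by_contra hne
    rw [not_or] at hne
    have : e ∈ randomEdges p := by
      simp only [randomEdges, Finset.mem_filter, Finset.mem_univ, true_and]
      exact hne
    rw [Finset.card_eq_zero] at hcard
    rw [hcard] at this
    exact absurd this (Finset.notMem_empty e)
  | succ n ih =>
    intro p hp hcard c hc a₂ hadm
    by_cases hdet : ∀ e ∈ touches ends (cluster ends (sureConfig p) a₂), p e = 0 ∨ p e = 1
    · exact crossC_nonneg_of_det hc hdet o a₁ v b
    · simp only [not_forall, not_or] at hdet
      obtain ⟨e, he, h0, h1⟩ := hdet
      obtain ⟨t, ht, w, hew⟩ := he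
      have hp0 : IsProbVec (Function.update p e 0) := hp.update e le_rfl zero_le_one
      have hp1 : IsProbVec (Function.update p e 1) := hp.update e zero_le_one le_rfl
      have hmem : e ∈ randomEdges p := by
        simp only [randomEdges, Finset.mem_filter, Finset.mem_univ, true_and]
        exact ⟨h0, h1⟩
      have hcard0 : (randomEdges (Function.update p e 0)).card = n := by
        rw [randomEdges_update_zero, Finset.card_erase_of_mem hmem, hcard]
        rfl
      have hcard1 : (randomEdges (Function.update p e 1)).card = n := by
        rw [randomEdges_update_one, Finset.card_erase_of_mem hmem, hcard]
        rfl
      have hind0 := ih _ hp0 hcard0 c hc a₂ (adm_update_zero hadm ⟨t, ht, w, hew⟩ h1)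
      have hind1 := ih _ hp1 hcard1 c hc a₂ (adm_update_one hadm ⟨t, ht, w, hew⟩)
      by_cases htw : t = w
      · subst htw
        rw [crossC_update_loop hew p c o a₁ a₂ v b] at hind0
        exact hind0
      · have htc : Conn ends (sureConfig p) a₂ t := ht
        have hre := crossC_reroot (R := R) p c htc o a₁ v b
        have hsure := sureConfig_update_zero (R := R) p h1
        have htc0 : Conn ends (sureConfig (Function.update p e 0)) a₂ t := by
          rw [hsure]
          exact htc
        have hre0 := crossC_reroot (R := R) (Function.update p e 0) c htc0 o a₁ v b
        have htc1 : Conn ends (sureConfig (Function.update p e 1)) a₂ t := by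
          rw [sureConfig_update_one]
          exact conn_mono (OneEdge.le_update_true _ _) htc
        have hre1 := crossC_reroot (R := R) (Function.update p e 1) c htc1 o a₁ v b
        rw [hre0] at hind0
        rw [hre1] at hind1
        rw [hre]
        have hadmt : Adm p c ends a₁ t v := adm_reroot htc hadm
        by_cases hw1 : w = a₁
        · subst hw1
          have hz := crossPatC_update_one_eq_zero (ends := ends) (a₁ := w) (a₂ := t) p c
            (by rw [hew, Sym2.eq_swap]) o v b
          apply crossC_nonneg_of_coeffs hp c e o w t v b
          · rwa [← crossC_eq_crossPatC]
          · rwa [← crossC_eq_crossPatC]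
          · rw [hz.1, hz.2, add_zero]
        · have hH := H p t w e c hp hew htw hw1 h0 h1 hadmt hind0 hind1
          apply crossC_nonneg_of_coeffs hp c e o a₁ t v b
          · rwa [← crossC_eq_crossPatC]
          · rwa [← crossC_eq_crossPatC]
          · exact hH

/-- **The sign of `crossA′so` from `A2Step`**: with `c = P(a₁ ↔ v in G ∖ {a₂}) ≤ π`. -/
theorem crossA'so_nonneg_of_a2Step {o a₁ v b : V} (H : A2Step (R := R) ends o a₁ v b)
    (p : E → R) (hp : IsProbVec p) (a₂ : V) : 0 ≤ crossA'so p ends o a₁ a₂ v b :=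
  crossA'so_nonneg_of_crossC hp o a₁ a₂ v b (prob_del_a2_le hp a₁ a₂ v)
    (crossC_nonneg_of_a2Step H p hp _ (prob_nonneg hp _) a₂ (adm_del_a2 hp a₁ a₂ v))

end Induction

end CrossAPrimeA2Induction

end Summit.Ventures.PercRepro2
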